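import Mathlib
import Summits.Ventures.HodgeRepro2.T7SupportKappaCartan
import Summits.Ventures.HodgeRepro2.Tier7.Line3.KappaDefiniteBound

/-!
# Tier 7 — LINE 3 support: naturality of the two-torus invariant `κ` and the transport to the archimedean model
(`Line3/KappaNatural.lean`; t7-L1-p5, gen 2; continued in `Line3/KappaArchimedean.lean`)

p1's `T7SupportTwoTorusInvariant` defines, over any field `E` with a ring involution `σ`, the double-coset invariant
`kappa σ d f γ = N(c₀₀)/(d₀ d′₀)` of a `2 × 2` matrix `γ` with respect to the hermitian form `herm σ d` (first basis =
the standard basis, discriminants `d`) and a second orthogonal basis `f`. L3-ARGUMENT §2a defines the same invariant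
for the real objects in adapted coordinates, and §2f's right-hand column item (1) asks for the DICTIONARY between
that κ and the model's (`T7SupportKappaCartan`: `κ = |(γh)₀₀|²` on `SU(1,1)`; `T7SupportCompactRegularPoint`: the same
on `U(2)`). This file proves that κ is NATURAL, so that the §2a invariant computed in ANY adapted coordinates is the
model's invariant:

* `kappaGen` — κ for two arbitrary bases `e, f` of a plane with a form `h`: `N(h(γ f₀, e₀)) / (h(e₀,e₀) h(f₀,f₀))`;
  `kappa_eq_kappaGen`: p1's κ is `kappaGen (herm σ d) std f`.
* `kappaGen_conj` — transport by an isometry `P` (`Q P = 1`): `kappaGen h′ (P e) (P f) (P γ Q) = kappaGen h e f γ`.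
* `kappaGen_smul` — rescaling either basis leaves κ unchanged; `kappa_smul_second`, `kappa_diagonal_conj` (a diagonal
  change of the first basis, with the induced discriminants `d i / N(l i)`).
* `kappa_map` — base change along a ring homomorphism `ψ : E →+* E′` intertwining the involutions:
  `ψ (kappa σ d f γ) = kappa σ′ (ψ ∘ d) (ψ ∘∘ f) (γ.map ψ)` — the global `κ(γ) ∈ F` IS the local invariant at every
  completion (§2a: «κ(γ) for γ ∈ U(W_A)(F) is the common value of its local invariants»).
* Over `ℂ` with `σ = conj` and REAL discriminants `r`: `P = diag(√|r₀|, √|r₁|)`, `Q = P⁻¹` carry the adapted form to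
  the sign-normalised model `herm conj (sgn r)`, `sgn r = (r i/|r i|) ∈ {±1}²` (`kappa_eq_kappa_sgn`; `sgn_eq_dd` for
  signature `(1,1)` = `T7SupportKappaCartan.dd`, `sgn_eq_one` for the definite signature); the normalised second basis
  `nf = (√|s_j|)⁻¹ • P f_j` and its column matrix `colMatrix (nf r s f)` give
  THE κ-HALF OF THE DICTIONARY (`kappa_eq_normSq`): for `r 0 > 0`, `r 1 ≠ 0`, `disc′ f 0 = s 0 > 0` and ANY `γ`,
  `kappa conj r f γ = Complex.normSq ((P γ Q · colMatrix (nf r s f)) 0 0)` — the Cartan size `|(γ′ h)₀₀|²` of the model in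
  the real coordinates (x1's open item (i), HANDOFF-t7-x1 §State). `isIsom_conj`: `P γ Q` is an isometry of the
  normalised form when `γ` is one of the adapted form. The group statements (`P γ Q`, `H ∈ U(1,1)` resp. `U(2)`, hence
  `κ ≥ 1` resp. `0 ≤ κ ≤ 1`) and the composition with base change are in `Line3/KappaArchimedean.lean`.

What this file does NOT do: nothing about the real group `U(W_A)(F_{ι_j})` itself — the identification of
`W_A ⊗_{ι_j} ℝ` with `(ℂ², diag(d₀, d₁))` is the choice of adapted coordinates, i.e. the printed data of §0 / (H12)
(TYPING-CENSUS T7: stays in words); nothing about periods, orbital integrals or (N). Pure algebra.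
Sorry-free; axioms: propext / Classical.choice / Quot.sound. §8(d): uses an L-value-free non-vanishing device: NO.
-/

namespace Summit.Ventures.HodgeRepro2.Tier7.Line3.KappaNatural

open Matrix Summit.Ventures.HodgeRepro2.T7SupportTwoTorusInvariant

section general

variable {E : Type*} [Field E] (σ : E →+* E)

/-! ## 1. κ for two arbitrary bases -/

/-- the standard basis `e_i` of `E²` -/
def std (i : Fin 2) : Fin 2 → E := Pi.single i 1

/-- the double-coset invariant for two arbitrary bases `e`, `f` of a plane with a form `h`:
`κ = N(h(γ f₀, e₀)) / (h(e₀, e₀) · h(f₀, f₀))` -/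
def kappaGen (h : (Fin 2 → E) → (Fin 2 → E) → E) (e f : Fin 2 → Fin 2 → E)
    (γ : Matrix (Fin 2) (Fin 2) E) : E :=
  nrm σ (h (γ *ᵥ f 0) (e 0)) / (h (e 0) (e 0) * h (f 0) (f 0))

/-- `herm σ d x e_i = d i · x i` -/
theorem herm_std_right (d : Fin 2 → E) (x : Fin 2 → E) (i : Fin 2) :
    herm σ d x (std i) = d i * x i := by
  unfold herm std
  fin_cases i <;> simp [Pi.single_apply]

/-- `herm σ d e_i e_i = d i` -/
theorem herm_std_std (d : Fin 2 → E) (i : Fin 2) : herm σ d (std i) (std i) = d i := by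
  rw [herm_std_right]
  unfold std
  simp

/-- p1's κ is `kappaGen` for the standard first basis -/
theorem kappa_eq_kappaGen (d : Fin 2 → E) (f : Fin 2 → Fin 2 → E) (γ : Matrix (Fin 2) (Fin 2) E) :
    kappa σ d f γ = kappaGen σ (herm σ d) std f γ := by
  unfold kappa kappaGen cc disc'
  rw [herm_std_right, herm_std_std]

/-! ## 2. Naturality: transport by an isometry, rescaling of the bases, base change -/

/-- **transport by an isometry**: if `P` carries the form `h` to `h′` and `Q P = 1`, then κ computed for the
transported bases `P e`, `P f` and the conjugate `P γ Q` is κ of `(e, f, γ)`. -/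
theorem kappaGen_conj (h h' : (Fin 2 → E) → (Fin 2 → E) → E) {P Q : Matrix (Fin 2) (Fin 2) E}
    (hiso : ∀ x y, h' (P *ᵥ x) (P *ᵥ y) = h x y) (hQP : Q * P = 1)
    (e f : Fin 2 → Fin 2 → E) (γ : Matrix (Fin 2) (Fin 2) E) :
    kappaGen σ h' (fun i => P *ᵥ e i) (fun j => P *ᵥ f j) (P * γ * Q) = kappaGen σ h e f γ := by
  unfold kappaGen
  have hv : (P * γ * Q) *ᵥ (P *ᵥ f 0) = P *ᵥ (γ *ᵥ f 0) := by
    rw [mulVec_mulVec, Matrix.mul_assoc, hQP, Matrix.mul_one, ← mulVec_mulVec]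
  simp only [hv, hiso]

/-- `herm σ d` is linear in the first slot -/
theorem herm_smul_left (d : Fin 2 → E) (c : E) (x y : Fin 2 → E) :
    herm σ d (c • x) y = c * herm σ d x y := by
  unfold herm
  rw [Finset.mul_sum]
  refine Finset.sum_congr rfl fun i _ => ?_
  simp only [Pi.smul_apply, smul_eq_mul]
  ring

/-- `herm σ d` is `σ`-semilinear in the second slot -/
theorem herm_smul_right (d : Fin 2 → E) (c : E) (x y : Fin 2 → E) :
    herm σ d x (c • y) = σ c * herm σ d x y := by
  unfold herm
  rw [Finset.mul_sum]
  refine Finset.sum_congr rfl fun i _ => ?_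
  rw [Pi.smul_apply, smul_eq_mul, map_mul]
  ring

/-- **rescaling the bases**: for a form `h` that is linear in the first and `σ`-semilinear in the second slot,
`e_i ↦ a_i e_i`, `f_j ↦ b_j f_j` (`a₀, b₀ ≠ 0`) leaves κ unchanged. -/
theorem kappaGen_smul (hσ : ∀ x, σ (σ x) = x) {h : (Fin 2 → E) → (Fin 2 → E) → E}
    (hl : ∀ (c : E) x y, h (c • x) y = c * h x y) (hr : ∀ (c : E) x y, h x (c • y) = σ c * h x y)
    (e f : Fin 2 → Fin 2 → E) (a b : Fin 2 → E) (ha : a 0 ≠ 0) (hb : b 0 ≠ 0)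
    (γ : Matrix (Fin 2) (Fin 2) E) :
    kappaGen σ h (fun i => a i • e i) (fun j => b j • f j) γ = kappaGen σ h e f γ := by
  have hna : nrm σ (a 0) ≠ 0 := nrm_ne_zero σ hσ ha
  have hnb : nrm σ (b 0) ≠ 0 := nrm_ne_zero σ hσ hb
  have hne : nrm σ (b 0) * nrm σ (a 0) ≠ 0 := mul_ne_zero hnb hna
  have h1 : h (γ *ᵥ (b 0 • f 0)) (a 0 • e 0) = b 0 * (σ (a 0) * h (γ *ᵥ f 0) (e 0)) := by
    rw [mulVec_smul, hl, hr]
  have h2 : h (a 0 • e 0) (a 0 • e 0) = nrm σ (a 0) * h (e 0) (e 0) := by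
    rw [hl, hr]
    unfold nrm
    ring
  have h3 : h (b 0 • f 0) (b 0 • f 0) = nrm σ (b 0) * h (f 0) (f 0) := by
    rw [hl, hr]
    unfold nrm
    ring
  show nrm σ (h (γ *ᵥ (b 0 • f 0)) (a 0 • e 0)) / (h (a 0 • e 0) (a 0 • e 0) * h (b 0 • f 0) (b 0 • f 0))
    = nrm σ (h (γ *ᵥ f 0) (e 0)) / (h (e 0) (e 0) * h (f 0) (f 0))
  rw [h1, h2, h3, nrm_mul, nrm_mul, nrm_sigma σ hσ]
  rw [show nrm σ (b 0) * (nrm σ (a 0) * nrm σ (h (γ *ᵥ f 0) (e 0))) =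
      (nrm σ (b 0) * nrm σ (a 0)) * nrm σ (h (γ *ᵥ f 0) (e 0)) by ring]
  rw [show nrm σ (a 0) * h (e 0) (e 0) * (nrm σ (b 0) * h (f 0) (f 0)) =
      (nrm σ (b 0) * nrm σ (a 0)) * (h (e 0) (e 0) * h (f 0) (f 0)) by ring]
  rw [mul_div_mul_left _ _ hne]

/-- rescaling the second basis of the model leaves κ unchanged (`b 0 ≠ 0`) -/
theorem kappa_smul_second (hσ : ∀ x, σ (σ x) = x) (d : Fin 2 → E) (f : Fin 2 → Fin 2 → E)
    (b : Fin 2 → E) (hb : b 0 ≠ 0) (γ : Matrix (Fin 2) (Fin 2) E) :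
    kappa σ d (fun j => b j • f j) γ = kappa σ d f γ := by
  rw [kappa_eq_kappaGen, kappa_eq_kappaGen]
  have := kappaGen_smul σ hσ (herm_smul_left σ d) (herm_smul_right σ d) std f (fun _ => 1) b
    one_ne_zero hb γ
  simpa only [one_smul] using this

/-- the diagonal matrix `diag l` is an isometry from `herm σ d` to `herm σ (d / N(l))` -/
theorem herm_diagonal_mulVec (d l : Fin 2 → E) (hl : ∀ i, l i ≠ 0) (x y : Fin 2 → E) :
    herm σ (fun i => d i / nrm σ (l i)) (diagonal l *ᵥ x) (diagonal l *ᵥ y) = herm σ d x y := by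
  unfold herm
  refine Finset.sum_congr rfl fun i _ => ?_
  simp only [mulVec_diagonal, map_mul]
  have h1 : l i ≠ 0 := hl i
  have h2 : σ (l i) ≠ 0 := (map_ne_zero σ).2 h1
  unfold nrm
  field_simp

/-- **a diagonal change of the first basis** (`e_i ↦ l_i⁻¹ e_i`, new coordinates `x ↦ diag l · x`,
discriminants `d i / N(l i)`, second basis `diag l · f_j`, matrix `diag l · γ · diag l⁻¹`) leaves κ unchanged. -/
theorem kappa_diagonal_conj (hσ : ∀ x, σ (σ x) = x) (d l : Fin 2 → E) (hl : ∀ i, l i ≠ 0)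
    (f : Fin 2 → Fin 2 → E) (γ : Matrix (Fin 2) (Fin 2) E) :
    kappa σ (fun i => d i / nrm σ (l i)) (fun j => diagonal l *ᵥ f j)
      (diagonal l * γ * diagonal (fun i => (l i)⁻¹)) = kappa σ d f γ := by
  rw [kappa_eq_kappaGen, kappa_eq_kappaGen]
  have hQP : diagonal (fun i => (l i)⁻¹) * diagonal l = 1 := by
    rw [diagonal_mul_diagonal, ← diagonal_one]
    congr 1
    funext i
    exact inv_mul_cancel₀ (hl i)
  have hconj := kappaGen_conj σ (herm σ d) (herm σ (fun i => d i / nrm σ (l i)))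
    (herm_diagonal_mulVec σ d l hl) hQP std f γ
  rw [← hconj]
  have hstd : (fun i => diagonal l *ᵥ std i) = fun i => l i • (std i : Fin 2 → E) := by
    funext i
    funext k
    simp only [mulVec_diagonal, std, Pi.smul_apply, Pi.single_apply, smul_eq_mul]
    split_ifs with hk
    · subst hk; ring
    · ring
  rw [hstd]
  have := kappaGen_smul σ hσ (herm_smul_left σ (fun i => d i / nrm σ (l i)))
    (herm_smul_right σ (fun i => d i / nrm σ (l i))) std
    (fun j => diagonal l *ᵥ f j) l (fun _ => 1) (hl 0) one_ne_zero
    (diagonal l * γ * diagonal (fun i => (l i)⁻¹))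
  simpa only [one_smul] using this.symm

/-- **base change**: a ring homomorphism `ψ : E →+* E′` intertwining the involutions carries κ to κ
(the global invariant is the local invariant at every completion). -/
theorem kappa_map {E' : Type*} [Field E'] (σ' : E' →+* E') (ψ : E →+* E')
    (hψ : ∀ x, ψ (σ x) = σ' (ψ x)) (d : Fin 2 → E) (f : Fin 2 → Fin 2 → E)
    (γ : Matrix (Fin 2) (Fin 2) E) :
    ψ (kappa σ d f γ) = kappa σ' (fun i => ψ (d i)) (fun j i => ψ (f j i)) (γ.map ψ) := by
  have hherm : ∀ x y : Fin 2 → E, ψ (herm σ d x y) =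
      herm σ' (fun i => ψ (d i)) (fun i => ψ (x i)) (fun i => ψ (y i)) := by
    intro x y
    unfold herm
    simp only [map_sum, map_mul, hψ]
  have hmul : ∀ (v : Fin 2 → E) (i : Fin 2), ψ ((γ *ᵥ v) i) = (γ.map ψ *ᵥ fun k => ψ (v k)) i := by
    intro v i
    simp only [mulVec, dotProduct, map_sum, map_mul, Matrix.map_apply]
  unfold kappa cc disc' nrm
  simp only [map_div₀, map_mul, hψ, hmul, hherm]

end general

/-! ## 3. Over `ℂ`: the archimedean dictionary -/

section complex

open Complex Summit.Ventures.HodgeRepro2.Tier7.Line3.KappaDefiniteBound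

/-- `conj` is an involution -/
theorem conj_conj' (z : ℂ) : (starRingEnd ℂ) ((starRingEnd ℂ) z) = z := Complex.conj_conj z

/-- the scaling factors `√|r i|` -/
noncomputable def sq (r : Fin 2 → ℝ) : Fin 2 → ℂ := fun i => (Real.sqrt |r i| : ℂ)

/-- the coordinate change `P = diag(√|r₀|, √|r₁|)` to the sign-normalised model -/
noncomputable def P (r : Fin 2 → ℝ) : Matrix (Fin 2) (Fin 2) ℂ := diagonal (sq r)

/-- `Q = P⁻¹ = diag(1/√|r₀|, 1/√|r₁|)` -/
noncomputable def Q (r : Fin 2 → ℝ) : Matrix (Fin 2) (Fin 2) ℂ := diagonal (fun i => (sq r i)⁻¹)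

/-- the signs `r i / |r i| ∈ {±1}` of the discriminants: the discriminants of the normalised model -/
noncomputable def sgn (r : Fin 2 → ℝ) : Fin 2 → ℂ := fun i => ((r i / |r i| : ℝ) : ℂ)

/-- `√|r i| ≠ 0` when `r i ≠ 0` -/
theorem sq_ne_zero_of_ne {r : Fin 2 → ℝ} {i : Fin 2} (hi : r i ≠ 0) : sq r i ≠ 0 := by
  unfold sq
  have : 0 < |r i| := abs_pos.2 hi
  exact_mod_cast (Real.sqrt_pos.2 this).ne'

/-- `√|r i| ≠ 0` for all `i` when no `r i` vanishes -/
theorem sq_ne_zero {r : Fin 2 → ℝ} (hr : ∀ i, r i ≠ 0) (i : Fin 2) : sq r i ≠ 0 :=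
  sq_ne_zero_of_ne (hr i)

/-- `N(x⁻¹) = N(x)⁻¹` -/
theorem nrm_inv' (x : ℂ) : nrm (starRingEnd ℂ) x⁻¹ = (nrm (starRingEnd ℂ) x)⁻¹ := by
  rw [inv_eq_one_div, nrm_div, nrm_one, inv_eq_one_div]

/-- `N(√|r i|) = |r i|` -/
theorem nrm_sq (r : Fin 2 → ℝ) (i : Fin 2) : nrm (starRingEnd ℂ) (sq r i) = ((|r i| : ℝ) : ℂ) := by
  rw [nrm_conjC]
  unfold sq
  rw [Complex.normSq_ofReal, Real.mul_self_sqrt (abs_nonneg _)]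

/-- the normalised discriminants are the signs -/
theorem div_nrm_sq_eq_sgn (r : Fin 2 → ℝ) :
    (fun i => ((r i : ℂ)) / nrm (starRingEnd ℂ) (sq r i)) = sgn r := by
  funext i
  rw [nrm_sq]
  unfold sgn
  push_cast
  rfl

/-- `Q P = 1` -/
theorem Q_mul_P {r : Fin 2 → ℝ} (hr : ∀ i, r i ≠ 0) : Q r * P r = 1 := by
  unfold Q P
  rw [diagonal_mul_diagonal, ← diagonal_one]
  congr 1
  funext i
  exact inv_mul_cancel₀ (sq_ne_zero hr i)

/-- `P Q = 1` -/
theorem P_mul_Q {r : Fin 2 → ℝ} (hr : ∀ i, r i ≠ 0) : P r * Q r = 1 := by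
  unfold Q P
  rw [diagonal_mul_diagonal, ← diagonal_one]
  congr 1
  funext i
  exact mul_inv_cancel₀ (sq_ne_zero hr i)

/-- `P` is an isometry from `herm conj r` onto `herm conj (sgn r)` -/
theorem herm_P_mulVec {r : Fin 2 → ℝ} (hr : ∀ i, r i ≠ 0) (x y : Fin 2 → ℂ) :
    herm (starRingEnd ℂ) (sgn r) (P r *ᵥ x) (P r *ᵥ y) = herm (starRingEnd ℂ) (fun i => (r i : ℂ)) x y := by
  rw [← div_nrm_sq_eq_sgn r]
  exact herm_diagonal_mulVec (starRingEnd ℂ) (fun i => (r i : ℂ)) (sq r) (sq_ne_zero hr) x y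

/-- **transport to the sign-normalised model**: κ in the adapted coordinates with real discriminants `r` is κ in
the model with discriminants `sgn r = (±1, ±1)`, second basis `P f` and matrix `P γ Q`. -/
theorem kappa_eq_kappa_sgn {r : Fin 2 → ℝ} (hr : ∀ i, r i ≠ 0) (f : Fin 2 → Fin 2 → ℂ)
    (γ : Matrix (Fin 2) (Fin 2) ℂ) :
    kappa (starRingEnd ℂ) (fun i => (r i : ℂ)) f γ =
      kappa (starRingEnd ℂ) (sgn r) (fun j => P r *ᵥ f j) (P r * γ * Q r) := by
  rw [← div_nrm_sq_eq_sgn r]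
  exact (kappa_diagonal_conj (starRingEnd ℂ) conj_conj' (fun i => (r i : ℂ)) (sq r) (sq_ne_zero hr) f γ).symm

/-- the signs for signature `(1,1)`: `sgn r = dd = ![1, -1]` of `T7SupportKappaCartan` -/
theorem sgn_eq_dd {r : Fin 2 → ℝ} (hr0 : 0 < r 0) (hr1 : r 1 < 0) :
    sgn r = T7SupportKappaCartan.dd := by
  funext i
  unfold sgn T7SupportKappaCartan.dd
  fin_cases i
  · simp [abs_of_pos hr0, div_self hr0.ne']
  · simp [abs_of_neg hr1, div_neg, div_self hr1.ne]

/-- the signs for the definite signature `(2,0)`: `sgn r = ![1, 1]` -/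
theorem sgn_eq_one {r : Fin 2 → ℝ} (hr0 : 0 < r 0) (hr1 : 0 < r 1) : sgn r = ![1, 1] := by
  funext i
  unfold sgn
  fin_cases i
  · simp [abs_of_pos hr0, div_self hr0.ne']
  · simp [abs_of_pos hr1, div_self hr1.ne']

/-- the normalised second basis `f′_j = (√|s_j|)⁻¹ • (P f_j)` (`s_j` = the discriminants of `f`) -/
noncomputable def nf (r s : Fin 2 → ℝ) (f : Fin 2 → Fin 2 → ℂ) : Fin 2 → Fin 2 → ℂ :=
  fun j => (sq s j)⁻¹ • (P r *ᵥ f j)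

/-- the matrix whose columns are the vectors `c 0, c 1` -/
def colMatrix (c : Fin 2 → Fin 2 → ℂ) : Matrix (Fin 2) (Fin 2) ℂ := Matrix.of fun i j => c j i

/-- `(g · colMatrix c) i j = (g c_j) i` -/
theorem mul_colMatrix_apply (g : Matrix (Fin 2) (Fin 2) ℂ) (c : Fin 2 → Fin 2 → ℂ) (i j : Fin 2) :
    (g * colMatrix c) i j = (g *ᵥ c j) i := by
  simp [colMatrix, Matrix.mul_apply, mulVec, dotProduct]

/-- the discriminant of the normalised vector `f′_j` is the sign `s j / |s j|` -/
theorem disc'_nf {r : Fin 2 → ℝ} (hr : ∀ i, r i ≠ 0) (s : Fin 2 → ℝ) (f : Fin 2 → Fin 2 → ℂ) (j : Fin 2)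
    (hfj : disc' (starRingEnd ℂ) (fun i => (r i : ℂ)) f j = (s j : ℂ)) :
    disc' (starRingEnd ℂ) (sgn r) (nf r s f) j = ((s j / |s j| : ℝ) : ℂ) := by
  unfold disc' nf
  rw [herm_smul_left, herm_smul_right, herm_P_mulVec hr]
  unfold disc' at hfj
  rw [hfj]
  have h1 : (sq s j)⁻¹ * (starRingEnd ℂ) (sq s j)⁻¹ = nrm (starRingEnd ℂ) (sq s j)⁻¹ := rfl
  rw [← mul_assoc, h1, nrm_inv', nrm_sq]
  push_cast
  rw [div_eq_inv_mul]

/-- the normalised vectors stay orthogonal -/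
theorem herm_nf_zero_one {r : Fin 2 → ℝ} (hr : ∀ i, r i ≠ 0) (s : Fin 2 → ℝ) (f : Fin 2 → Fin 2 → ℂ)
    (horth : herm (starRingEnd ℂ) (fun i => (r i : ℂ)) (f 0) (f 1) = 0) :
    herm (starRingEnd ℂ) (sgn r) (nf r s f 0) (nf r s f 1) = 0 := by
  unfold nf
  rw [herm_smul_left, herm_smul_right, herm_P_mulVec hr, horth, mul_zero, mul_zero]

/-- **THE DICTIONARY, κ half**: for real discriminants `r` with `r 0 > 0`, `r 1 ≠ 0`, a second basis `f` with
`disc′ f 0 = s 0 > 0`, and ANY `γ`: κ in the adapted coordinates is the squared modulus of the `(0,0)`-entry of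
`P γ Q · H`, `H` = the matrix of the normalised second basis — the Cartan size of `T7SupportKappaCartan`
(signature `(1,1)`) and of `T7SupportCompactRegularPoint` (definite) in the real coordinates. -/
theorem kappa_eq_normSq {r : Fin 2 → ℝ} (hr0 : 0 < r 0) (hr1 : r 1 ≠ 0) {s : Fin 2 → ℝ} (hs0 : 0 < s 0)
    (f : Fin 2 → Fin 2 → ℂ) (hf0 : disc' (starRingEnd ℂ) (fun i => (r i : ℂ)) f 0 = (s 0 : ℂ))
    (γ : Matrix (Fin 2) (Fin 2) ℂ) :
    kappa (starRingEnd ℂ) (fun i => (r i : ℂ)) f γ =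
      (Complex.normSq ((P r * γ * Q r * colMatrix (nf r s f)) 0 0) : ℂ) := by
  have hr : ∀ i, r i ≠ 0 := by
    intro i
    fin_cases i
    · exact hr0.ne'
    · exact hr1
  rw [kappa_eq_kappa_sgn hr]
  have key := kappa_smul_second (starRingEnd ℂ) conj_conj' (sgn r) (fun j => P r *ᵥ f j)
    (fun j => (sq s j)⁻¹) (inv_ne_zero (sq_ne_zero_of_ne hs0.ne')) (P r * γ * Q r)
  rw [← key]
  change kappa (starRingEnd ℂ) (sgn r) (nf r s f) (P r * γ * Q r) = _
  unfold kappa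
  rw [disc'_nf hr s f 0 hf0, abs_of_pos hs0, div_self hs0.ne']
  have hs : sgn r 0 = 1 := by
    unfold sgn
    rw [abs_of_pos hr0, div_self hr0.ne']
    simp
  unfold cc
  rw [hs, nrm_conjC, mul_colMatrix_apply]
  simp


/-- the conjugate `P γ Q` of an isometry of the adapted form is an isometry of the sign-normalised form -/
theorem isIsom_conj {r : Fin 2 → ℝ} (hr : ∀ i, r i ≠ 0) {γ : Matrix (Fin 2) (Fin 2) ℂ}
    (hγ : IsIsom (starRingEnd ℂ) (fun i => (r i : ℂ)) γ) :
    IsIsom (starRingEnd ℂ) (sgn r) (P r * γ * Q r) := by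
  intro x y
  have h1 : (P r * γ * Q r) *ᵥ x = P r *ᵥ (γ *ᵥ (Q r *ᵥ x)) := by
    rw [mulVec_mulVec, mulVec_mulVec]
  have h2 : (P r * γ * Q r) *ᵥ y = P r *ᵥ (γ *ᵥ (Q r *ᵥ y)) := by
    rw [mulVec_mulVec, mulVec_mulVec]
  rw [h1, h2, herm_P_mulVec hr, hγ, ← herm_P_mulVec hr, mulVec_mulVec, mulVec_mulVec, P_mul_Q hr,
    one_mulVec, one_mulVec]
end complex

end Summit.Ventures.HodgeRepro2.Tier7.Line3.KappaNatural
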